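import Literature.NumberTheory.Transcendental.SchneiderTwoWeierstrassDefs
import HarnessLib

/-!
# Schneider's theorem for two Weierstrass functions — the analytic half

Topic `Literature/NumberTheory/Transcendental` (family `periods`). Second file of the two-lattice
companion of `SchneiderPeriodsAnalytic.lean` (definitions: `SchneiderTwoWeierstrassDefs.lean`):
Baker's Theorem 6.1 (Baker 1975, Ch. 6 §§3–5) run for `℘₁, ℘₁', ℘₂, ℘₂'` of two period pairs
`L₁, L₂` sharing a lattice vector `l` with `l/2 ∉ Λ₁ ∪ Λ₂`, at the points `pt l n = l/2 + n l`,
with the auxiliary function `F₂ L₁ L₂ D p z = ∑ p (i,k) ℘₁(z)ⁱ ℘₂(z)ᵏ` (Th. Schneider, Math. Ann.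
113 (1937); Baker 1975, proof of Thm 6.3, p. 58). This is the analytic part (Baker, Ch. 6, §4
Lemma 3 and §5), a line-by-line port of the one-lattice file in which the multiplier `σ^{2D}`
becomes `σ₁^{2D} σ₂^{2D}` (the pattern of `MasserThmIAnalytic.lean`):

* `G₂` — the ENTIRE function `∑ p (i,k) (σ₁²℘₁)ⁱ σ₁^{2(D-i)} (σ₂²℘₂)ᵏ σ₂^{2(D-k)}
  = σ₁^{2D} σ₂^{2D} F₂` off `Λ₁ ∪ Λ₂` (`G₂_eq`), of order-two growth (`norm_G₂_le`);
* `norm_G₂_le_of_zeros` — Schwarz's lemma (`Baker1975.Analytic.norm_le_of_analyticOrderAt`);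
* `norm_iteratedDeriv_F₂_le_of_zeros` — division by `σ₁^{2D} σ₂^{2D}` on small circles and
  Cauchy's inequality, with the SAME output shape as the one-lattice version;
* `analyticOrderAt_F₂_ne_top` — if `F₂ ≢ 0` off `Λ₁ ∪ Λ₂`, it has finite order at every `pt l n`
  (identity theorem on the connected open set `ℂ ∖ (Λ₁ ∪ Λ₂)`).

NOT here: the one-lattice `eq_zero_of_F_eq_zero` has no analogue (`℘₁`, `℘₂` may be algebraically
dependent — that is the point of the series), so non-vanishing of `F₂` is a hypothesis of
`analyticOrderAt_F₂_ne_top`; value formula, Siegel, Liouville, endgame are the sibling files.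

## References

* [Baker1975] A. Baker, *Transcendental Number Theory*, CUP 1975, Ch. 6 §§1–5, pp. 55–59.
* [Schneider1937] Th. Schneider, *Arithmetische Untersuchungen elliptischer Integrale*,
  Math. Ann. 113 (1937), 1–13.
-/

noncomputable section

open Complex Metric Filter Set Finset
open _root_.Topology
open scoped PeriodPair

namespace Literature.NumberTheory.Transcendental.Schneider1937TwoP

open Literature.NumberTheory.Transcendental.Schneider1937 (pt e pt_notMem ne_zero_of_half_notMem
  pts card_pts mem_pts ρ₀ one_le_ρ₀ norm_pt_add_le exists_closedBall_pt_subset exists_sigma_lower)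
open Literature.NumberTheory.Transcendental.Chudnovsky (Sp sigma_sq_mul_weierstrassP
  differentiable_Sp exists_bound_Sg_Sp_sigma norm_apply_le)

section Analytic

variable (L₁ L₂ : PeriodPair) (l : ℂ)

/-! ### The entire function `G_p = σ₁^{2D} σ₂^{2D} F_p` -/

/-- The entire function `G_p = ∑ p (i,k) (σ₁²℘₁)ⁱ σ₁^{2(D-i)} (σ₂²℘₂)ᵏ σ₂^{2(D-k)}`, equal to
`σ₁^{2D} σ₂^{2D} F_p` off the two lattices (Baker's `φ = (h₁ ⋯ hₙ)^L Φ`; `σᵢ²℘ᵢ` is the entire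
function `Chudnovsky.Sp Lᵢ = σᵢ'² - σᵢσᵢ''`). [cite: Baker1975, Ch. 6 §4 Lemma 3 p. 58] -/
def G₂ (D : ℕ) (p : Fin (D + 1) × Fin (D + 1) → ℂ) (z : ℂ) : ℂ :=
  ∑ ij, p ij * ((Sp L₁ z ^ (ij.1 : ℕ) * L₁.weierstrassSigma z ^ (2 * (D - ij.1))) *
    (Sp L₂ z ^ (ij.2 : ℕ) * L₂.weierstrassSigma z ^ (2 * (D - ij.2))))

variable {L₁ L₂ l} {D : ℕ}

/-- `F_p` is analytic at every point off both lattices. [folklore] -/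
theorem analyticAt_F₂ (p : Fin (D + 1) × Fin (D + 1) → ℂ) {z : ℂ} (hz₁ : z ∉ L₁.lattice)
    (hz₂ : z ∉ L₂.lattice) : AnalyticAt ℂ (F₂ L₁ L₂ D p) z := by
  have h1 := L₁.analyticOnNhd_weierstrassP z hz₁
  have h2 := L₂.analyticOnNhd_weierstrassP z hz₂
  unfold F₂
  refine Finset.analyticAt_fun_sum _ fun ij _ => ?_
  exact analyticAt_const.mul ((h1.pow _).mul (h2.pow _))

/-- `F_p` is analytic on `(Λ₁ ∪ Λ₂)ᶜ`. [folklore] -/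
theorem analyticOnNhd_F₂ (p : Fin (D + 1) × Fin (D + 1) → ℂ) :
    AnalyticOnNhd ℂ (F₂ L₁ L₂ D p) ((L₁.lattice : Set ℂ) ∪ L₂.lattice)ᶜ := fun _ hz => by
  rw [Set.compl_union] at hz
  exact analyticAt_F₂ p hz.1 hz.2

/-- `(σ²℘)(u)^i σ(u)^{2(n-i)} = σ(u)^{2n} ℘(u)^i` off the lattice (`i ≤ n`). [folklore] -/
theorem Sp_pow_mul_sigma_pow (L : PeriodPair) {u : ℂ} (hu : u ∉ L.lattice) {n i : ℕ}
    (hi : i ≤ n) :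
    Sp L u ^ i * L.weierstrassSigma u ^ (2 * (n - i)) =
      L.weierstrassSigma u ^ (2 * n) * ℘[L] u ^ i := by
  -- adapted from `Masser1975.Sp_pow_mul_sigma_pow` (`MasserThmIAnalytic.lean`)
  rw [← sigma_sq_mul_weierstrassP L hu, mul_pow, ← pow_mul,
    show 2 * n = 2 * i + 2 * (n - i) by omega, pow_add]
  ring

/-- `G_p = σ₁^{2D} σ₂^{2D} F_p` off the two lattices. [folklore] -/
theorem G₂_eq {z : ℂ} (hz₁ : z ∉ L₁.lattice) (hz₂ : z ∉ L₂.lattice)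
    (p : Fin (D + 1) × Fin (D + 1) → ℂ) :
    G₂ L₁ L₂ D p z =
      L₁.weierstrassSigma z ^ (2 * D) * L₂.weierstrassSigma z ^ (2 * D) * F₂ L₁ L₂ D p z := by
  unfold G₂ F₂
  rw [Finset.mul_sum]
  refine Finset.sum_congr rfl fun ij _ => ?_
  rw [Sp_pow_mul_sigma_pow L₁ hz₁ (Nat.lt_succ_iff.mp ij.1.isLt),
    Sp_pow_mul_sigma_pow L₂ hz₂ (Nat.lt_succ_iff.mp ij.2.isLt)]
  ring

/-- `G_p` and `σ₁^{2D} σ₂^{2D} F_p` agree near every point off both lattices. [folklore] -/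
theorem G₂_eventuallyEq {z : ℂ} (hz₁ : z ∉ L₁.lattice) (hz₂ : z ∉ L₂.lattice)
    (p : Fin (D + 1) × Fin (D + 1) → ℂ) :
    G₂ L₁ L₂ D p =ᶠ[𝓝 z]
      (fun w => L₁.weierstrassSigma w ^ (2 * D) * L₂.weierstrassSigma w ^ (2 * D)) *
        F₂ L₁ L₂ D p := by
  filter_upwards [L₁.isClosed_lattice.isOpen_compl.mem_nhds hz₁,
    L₂.isClosed_lattice.isOpen_compl.mem_nhds hz₂] with w hw₁ hw₂
  exact G₂_eq hw₁ hw₂ p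

/-- `G_p` is entire. [folklore] -/
theorem differentiable_G₂ (p : Fin (D + 1) × Fin (D + 1) → ℂ) :
    Differentiable ℂ (G₂ L₁ L₂ D p) := by
  have hσ₁ : Differentiable ℂ L₁.weierstrassSigma := L₁.differentiable_weierstrassSigma_holds
  have hσ₂ : Differentiable ℂ L₂.weierstrassSigma := L₂.differentiable_weierstrassSigma_holds
  have h1 := differentiable_Sp L₁
  have h2 := differentiable_Sp L₂
  unfold G₂
  fun_prop

variable (L₁ L₂) in
/-- **Growth of `G_p`** (Baker 1975, Ch. 6, Lemma 3: "`|φ(z)| < exp{c₁₁(k log k + L R^ρ)}`"):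
`‖G_p(z)‖ ≤ ‖p‖ exp(C (D+1)(1+|z|²))` with `C` depending only on the two lattices.
[cite: Baker1975, Ch. 6 §4 Lemma 3 p. 58] -/
theorem norm_G₂_le :
    ∃ C : ℝ, 0 ≤ C ∧ ∀ (D : ℕ) (p : Fin (D + 1) × Fin (D + 1) → ℂ) (z : ℂ),
      ‖G₂ L₁ L₂ D p z‖ ≤ ‖p‖ * Real.exp (C * (D + 1) * (1 + ‖z‖ ^ 2)) := by
  obtain ⟨C₁, hC₁, h₁⟩ := exists_bound_Sg_Sp_sigma L₁
  obtain ⟨C₂, hC₂, h₂⟩ := exists_bound_Sg_Sp_sigma L₂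
  refine ⟨4 * (C₁ + C₂) + 2, by positivity, fun D p z => ?_⟩
  obtain ⟨-, hSp₁, hσ₁⟩ := h₁ z
  obtain ⟨-, hSp₂, hσ₂⟩ := h₂ z
  set t : ℝ := 1 + ‖z‖ ^ 2 with ht
  have ht1 : 1 ≤ t := by nlinarith [norm_nonneg z]
  have ht0 : 0 ≤ t := zero_le_one.trans ht1
  -- common bound `E = exp((C₁+C₂) t)` for `σ₁²℘₁, σ₁, σ₂²℘₂, σ₂`; each term is `≤ ‖p‖ E^{4D}`
  set E : ℝ := Real.exp ((C₁ + C₂) * t) with hE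
  have hE1 : 1 ≤ E := Real.one_le_exp (by positivity)
  have e₁ : Real.exp (C₁ * t) ≤ E := Real.exp_le_exp.mpr (by nlinarith [mul_nonneg hC₂ ht0])
  have e₂ : Real.exp (C₂ * t) ≤ E := Real.exp_le_exp.mpr (by nlinarith [mul_nonneg hC₁ ht0])
  obtain ⟨hS₁, hs₁⟩ : ‖Sp L₁ z‖ ≤ E ∧ ‖L₁.weierstrassSigma z‖ ≤ E := ⟨hSp₁.trans e₁, hσ₁.trans e₁⟩
  obtain ⟨hS₂, hs₂⟩ : ‖Sp L₂ z‖ ≤ E ∧ ‖L₂.weierstrassSigma z‖ ≤ E := ⟨hSp₂.trans e₂, hσ₂.trans e₂⟩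
  have hterm : ∀ ij : Fin (D + 1) × Fin (D + 1),
      ‖p ij * ((Sp L₁ z ^ (ij.1 : ℕ) * L₁.weierstrassSigma z ^ (2 * (D - ij.1))) *
        (Sp L₂ z ^ (ij.2 : ℕ) * L₂.weierstrassSigma z ^ (2 * (D - ij.2))))‖ ≤
        ‖p‖ * E ^ (4 * D) := by
    intro ij
    have hl1 : (ij.1 : ℕ) ≤ D := Nat.lt_succ_iff.mp ij.1.isLt
    have hl2 : (ij.2 : ℕ) ≤ D := Nat.lt_succ_iff.mp ij.2.isLt
    rw [norm_mul, norm_mul, norm_mul, norm_mul, norm_pow, norm_pow, norm_pow, norm_pow]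
    refine mul_le_mul (norm_apply_le p ij) ?_ (by positivity) (norm_nonneg _)
    calc _ ≤ E ^ (ij.1 : ℕ) * E ^ (2 * (D - ij.1)) * (E ^ (ij.2 : ℕ) * E ^ (2 * (D - ij.2))) := by
          gcongr
      _ = E ^ ((ij.1 : ℕ) + 2 * (D - ij.1) + ((ij.2 : ℕ) + 2 * (D - ij.2))) := by
          rw [← pow_add, ← pow_add, ← pow_add]
      _ ≤ E ^ (4 * D) := pow_le_pow_right₀ hE1 (by omega)
  have hcard : (Finset.univ : Finset (Fin (D + 1) × Fin (D + 1))).card = (D + 1) ^ 2 := by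
    simp [sq]
  have hD1 : ((D : ℝ) + 1) ^ 2 ≤ Real.exp (2 * (D + 1) * t) := by
    have h0 : (D : ℝ) + 1 ≤ Real.exp ((D + 1) * t) :=
      (Real.add_one_le_exp _).trans (Real.exp_le_exp.mpr (by nlinarith))
    rw [show 2 * ((D : ℝ) + 1) * t = ((2 : ℕ) : ℝ) * ((D + 1) * t) by push_cast; ring,
      Real.exp_nat_mul]
    gcongr
  calc ‖G₂ L₁ L₂ D p z‖
      ≤ ∑ ij, ‖p ij * ((Sp L₁ z ^ (ij.1 : ℕ) * L₁.weierstrassSigma z ^ (2 * (D - ij.1))) *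
          (Sp L₂ z ^ (ij.2 : ℕ) * L₂.weierstrassSigma z ^ (2 * (D - ij.2))))‖ := norm_sum_le _ _
    _ ≤ ∑ _ij : Fin (D + 1) × Fin (D + 1), ‖p‖ * E ^ (4 * D) :=
        Finset.sum_le_sum fun ij _ => hterm ij
    _ = ((D : ℝ) + 1) ^ 2 * (‖p‖ * E ^ (4 * D)) := by
        rw [Finset.sum_const, hcard, nsmul_eq_mul]; push_cast; ring
    _ ≤ Real.exp (2 * (D + 1) * t) * (‖p‖ * E ^ (4 * D)) := by gcongr
    _ = ‖p‖ * (Real.exp (2 * (D + 1) * t) * E ^ (4 * D)) := by ring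
    _ ≤ ‖p‖ * Real.exp ((4 * (C₁ + C₂) + 2) * (D + 1) * t) := by
        gcongr
        rw [hE, ← Real.exp_nat_mul, ← Real.exp_add]
        apply Real.exp_le_exp.mpr
        have : 0 ≤ (C₁ + C₂) * t := by positivity
        push_cast
        nlinarith

/-! ### Zeros of high order at the points `pt l n` and Schwarz's lemma -/

/-- If `F_p^{(j)}(pt l n) = 0` for `j < S` then the entire function `G_p = σ₁^{2D} σ₂^{2D} F_p`
vanishes to order `≥ S` at `pt l n`. [folklore] -/
theorem le_analyticOrderAt_G₂ (hl₁ : l ∈ L₁.lattice) (hl2₁ : l / 2 ∉ L₁.lattice)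
    (hl₂ : l ∈ L₂.lattice) (hl2₂ : l / 2 ∉ L₂.lattice)
    (p : Fin (D + 1) × Fin (D + 1) → ℂ) {S n : ℕ}
    (h : ∀ j < S, iteratedDeriv j (F₂ L₁ L₂ D p) (pt l n) = 0) :
    (S : ℕ∞) ≤ analyticOrderAt (G₂ L₁ L₂ D p) (pt l n) := by
  have hc₁ : pt l n ∉ L₁.lattice := pt_notMem hl₁ hl2₁ n
  have hc₂ : pt l n ∉ L₂.lattice := pt_notMem hl₂ hl2₂ n
  have h2 : (S : ℕ∞) ≤ analyticOrderAt (F₂ L₁ L₂ D p) (pt l n) :=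
    (natCast_le_analyticOrderAt_iff_iteratedDeriv_eq_zero (analyticAt_F₂ p hc₁ hc₂)).mpr h
  have hd₁ : Differentiable ℂ L₁.weierstrassSigma := L₁.differentiable_weierstrassSigma_holds
  have hd₂ : Differentiable ℂ L₂.weierstrassSigma := L₂.differentiable_weierstrassSigma_holds
  have hσ : AnalyticAt ℂ
      (fun w => L₁.weierstrassSigma w ^ (2 * D) * L₂.weierstrassSigma w ^ (2 * D)) (pt l n) :=
    ((hd₁.analyticAt _).pow _).mul ((hd₂.analyticAt _).pow _)
  rw [analyticOrderAt_congr (G₂_eventuallyEq hc₁ hc₂ p),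
    analyticOrderAt_mul hσ (analyticAt_F₂ p hc₁ hc₂)]
  exact le_add_left h2

variable (L₁ L₂) in
/-- **Schwarz's lemma for `G_p`** (Baker 1975, Ch. 6, §5: the integral over `|z| = R` against
`∏ (z - y_i)^j`). If `F_p^{(j)}(pt l n) = 0` for all `j < S`, `n < m`, then for `ρ ≥ ρ₀ m`,
`R ≥ 2ρ` and `|w| ≤ ρ`, `‖G_p(w)‖ ≤ ‖p‖ exp(C (D+1)(1+R²)) (4ρ/R)^{S m}` (`G_p` has `m` zeros of
order `≥ S` in `|z| ≤ ρ`; compare with its maximum on `|z| = R`). [cite: Baker1975, Ch. 6 §5 p. 59] -/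
theorem norm_G₂_le_of_zeros (hl₁ : l ∈ L₁.lattice) (hl2₁ : l / 2 ∉ L₁.lattice)
    (hl₂ : l ∈ L₂.lattice) (hl2₂ : l / 2 ∉ L₂.lattice) :
    ∃ C : ℝ, 0 ≤ C ∧ ∀ (D S m : ℕ) (p : Fin (D + 1) × Fin (D + 1) → ℂ),
      (∀ n < m, ∀ j < S, iteratedDeriv j (F₂ L₁ L₂ D p) (pt l n) = 0) →
      ∀ ρ : ℝ, ρ₀ l m ≤ ρ → ∀ R : ℝ, 2 * ρ ≤ R → ∀ w : ℂ, ‖w‖ ≤ ρ →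
        ‖G₂ L₁ L₂ D p w‖ ≤
          ‖p‖ * Real.exp (C * (D + 1) * (1 + R ^ 2)) * (4 * ρ / R) ^ (S * m) := by
  obtain ⟨C, hC, hG⟩ := norm_G₂_le L₁ L₂
  refine ⟨C, hC, fun D S m p hF ρ hρ R hR w hw => ?_⟩
  have hl0 : l ≠ 0 := ne_zero_of_half_notMem hl2₁
  have hρ1 : 1 ≤ ρ := (one_le_ρ₀ m).trans hρ
  have hρ0 : 0 < ρ := by linarith
  have hR0 : 0 < R := by linarith
  set S' := pts l m
  have hcard : S'.card = m := card_pts hl0 m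
  have hcS : ∀ x ∈ S', ‖x‖ ≤ ρ := by
    intro x hx
    obtain ⟨n, hn, rfl⟩ := mem_pts hx
    have := norm_pt_add_le (l := l) hn (u := 0) (by simp)
    rw [add_zero] at this
    exact this.trans hρ
  have hord : ∀ x ∈ S', (S : ℕ∞) ≤ analyticOrderAt (G₂ L₁ L₂ D p) x := by
    intro x hx
    obtain ⟨n, hn, rfl⟩ := mem_pts hx
    exact le_analyticOrderAt_G₂ hl₁ hl2₁ hl₂ hl2₂ p (hF n hn)
  set θ : ℝ := ‖p‖ * Real.exp (C * (D + 1) * (1 + R ^ 2))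
  have hθb : ∀ z ∈ sphere (0 : ℂ) R, ‖G₂ L₁ L₂ D p z‖ ≤ θ := by
    intro z hz
    rw [mem_sphere_zero_iff_norm] at hz
    have := hG D p z
    rwa [hz] at this
  have hmF : ∀ z ∈ sphere (0 : ℂ) R, (R - ρ) ^ (S * S'.card) ≤ ‖∏ x ∈ S', (z - x) ^ S‖ := by
    intro z hz
    rw [mem_sphere_zero_iff_norm] at hz
    refine Baker1975.Analytic.le_norm_prod_pow S' S (by linarith) fun x hx => ?_
    calc R - ρ ≤ ‖z‖ - ‖x‖ := by rw [hz]; linarith [hcS x hx]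
      _ ≤ ‖z - x‖ := norm_sub_norm_le z x
  have hwF : ‖∏ x ∈ S', (w - x) ^ S‖ ≤ (2 * ρ) ^ (S * S'.card) :=
    Baker1975.Analytic.norm_prod_pow_le S' S fun x hx =>
      calc ‖w - x‖ ≤ ‖w‖ + ‖x‖ := norm_sub_le w x
        _ ≤ 2 * ρ := by linarith [hcS x hx]
  have hm0 : (0 : ℝ) < (R - ρ) ^ (S * S'.card) := pow_pos (by linarith) _
  have key := Baker1975.Analytic.norm_le_of_analyticOrderAt (differentiable_G₂ p) S' S hord
    hR0 hθb hm0 hmF (w := w) (by linarith)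
  have hθ0 : 0 ≤ θ := by positivity
  calc ‖G₂ L₁ L₂ D p w‖ ≤ θ / (R - ρ) ^ (S * S'.card) * ‖∏ x ∈ S', (w - x) ^ S‖ := key
    _ ≤ θ / (R - ρ) ^ (S * S'.card) * (2 * ρ) ^ (S * S'.card) := by gcongr
    _ = θ * ((2 * ρ) / (R - ρ)) ^ (S * m) := by
        rw [hcard, div_pow]; field_simp
    _ ≤ θ * (4 * ρ / R) ^ (S * m) := by
        refine mul_le_mul_of_nonneg_left
          (pow_le_pow_left₀ (div_nonneg (by linarith) (by linarith)) ?_ _) hθ0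
        rw [div_le_div_iff₀ (by linarith) hR0]
        nlinarith

/-! ### Division by `σ₁^{2D} σ₂^{2D}` and Cauchy's inequality -/

/-- Off both lattices, `‖F_p(z)‖ = ‖G_p(z)‖ / (‖σ₁(z)‖^{2D} ‖σ₂(z)‖^{2D})`. [folklore] -/
theorem norm_F₂_eq {z : ℂ} (hz₁ : z ∉ L₁.lattice) (hz₂ : z ∉ L₂.lattice)
    (p : Fin (D + 1) × Fin (D + 1) → ℂ) :
    ‖F₂ L₁ L₂ D p z‖ = ‖G₂ L₁ L₂ D p z‖ /
      (‖L₁.weierstrassSigma z‖ ^ (2 * D) * ‖L₂.weierstrassSigma z‖ ^ (2 * D)) := by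
  have hσ₁ := L₁.weierstrassSigma_ne_zero hz₁
  have hσ₂ := L₂.weierstrassSigma_ne_zero hz₂
  rw [G₂_eq hz₁ hz₂ p, norm_mul, norm_mul, norm_pow, norm_pow]
  field_simp

variable (L₁ L₂) in
/-- The complement of the union of the two lattices is preconnected (complement of a countable
set in a real vector space of rank `> 1`). [folklore] -/
lemma isPreconnected_compl_union : IsPreconnected (((L₁.lattice : Set ℂ) ∪ L₂.lattice)ᶜ) :=
  (Set.Countable.isConnected_compl_of_one_lt_rank (by simp)
    (L₁.countable_lattice.union L₂.countable_lattice)).isPreconnected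

end Analytic

/-- **The fundamental upper bound** (Baker 1975, Ch. 6, §5: "`|φ^{(j)}(y_l)| ≤ j^{c₁₃ j - jm/(8ρ)}`").
There is a constant `C ≥ 0` (depending on the two lattices, `l` and `m`) such that: if
`F_p^{(j)}(pt l n) = 0` for `j < S`, `n < m`, then for every `ν < m`, `k`, `ρ ≥ ρ₀ m`, `R ≥ 2ρ`,
`‖F_p^{(k)}(pt l ν)‖ ≤ ‖p‖ · k! · exp(C ((D+1)(1+R²) + k)) · (4ρ/R)^{S m}` — Schwarz's lemma for
`G_p`, division by `σ₁^{2D} σ₂^{2D}` on a circle `|w - pt l ν| = δ` missing both lattices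
(`|σᵢ| ≥ c₀ > 0` there), Cauchy's inequality. [cite: Baker1975, Ch. 6 §5 p. 59] -/
theorem norm_iteratedDeriv_F₂_le_of_zeros {L₁ L₂ : PeriodPair} {l : ℂ} (hl₁ : l ∈ L₁.lattice)
    (hl2₁ : l / 2 ∉ L₁.lattice) (hl₂ : l ∈ L₂.lattice) (hl2₂ : l / 2 ∉ L₂.lattice) (m : ℕ) :
    ∃ C : ℝ, 0 ≤ C ∧ ∀ (D S : ℕ) (p : Fin (D + 1) × Fin (D + 1) → ℂ),
      (∀ n < m, ∀ j < S, iteratedDeriv j (F₂ L₁ L₂ D p) (pt l n) = 0) →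
      ∀ ν < m, ∀ (k : ℕ) (ρ : ℝ), ρ₀ l m ≤ ρ → ∀ R : ℝ, 2 * ρ ≤ R →
        ‖iteratedDeriv k (F₂ L₁ L₂ D p) (pt l ν)‖ ≤
          ‖p‖ * k.factorial * Real.exp (C * ((D + 1) * (1 + R ^ 2) + k)) *
            (4 * ρ / R) ^ (S * m) := by
  -- a common radius `δ ∈ (0, 1]`: the closed `δ`-discs around the points miss both lattices
  obtain ⟨δ₁, hδ₁, hδ₁1, hball₁⟩ := exists_closedBall_pt_subset hl₁ hl2₁
  obtain ⟨δ₂, hδ₂, -, hball₂⟩ := exists_closedBall_pt_subset hl₂ hl2₂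
  set δ : ℝ := min δ₁ δ₂
  have hδ : 0 < δ := lt_min hδ₁ hδ₂
  have hδ1 : δ ≤ 1 := (min_le_left _ _).trans hδ₁1
  have hb₁ : ∀ n : ℕ, closedBall (pt l n) δ ⊆ (L₁.lattice : Set ℂ)ᶜ := fun n =>
    (closedBall_subset_closedBall (min_le_left _ _)).trans (hball₁ n)
  have hb₂ : ∀ n : ℕ, closedBall (pt l n) δ ⊆ (L₂.lattice : Set ℂ)ᶜ := fun n =>
    (closedBall_subset_closedBall (min_le_right _ _)).trans (hball₂ n)
  -- a common lower bound `c₀ ∈ (0, 1]` for `|σ₁|`, `|σ₂|` on the circles `|w - pt l n| = δ`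
  obtain ⟨c₁, hc₁, hc₁1, hlow₁⟩ := exists_sigma_lower hb₁ m
  obtain ⟨c₂, hc₂, -, hlow₂⟩ := exists_sigma_lower hb₂ m
  set c₀ : ℝ := min c₁ c₂
  have hc₀ : 0 < c₀ := lt_min hc₁ hc₂
  have hc₀1 : c₀ ≤ 1 := (min_le_left _ _).trans hc₁1
  obtain ⟨CA, hCA, hA⟩ := norm_G₂_le_of_zeros L₁ L₂ hl₁ hl2₁ hl₂ hl2₂
  have hlog : 0 ≤ Real.log c₀⁻¹ := Real.log_nonneg (one_le_inv₀ hc₀ |>.mpr hc₀1)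
  have hlogδ : 0 ≤ Real.log δ⁻¹ := Real.log_nonneg (one_le_inv₀ hδ |>.mpr hδ1)
  refine ⟨CA + 4 * Real.log c₀⁻¹ + Real.log δ⁻¹, by positivity,
    fun D S p hF ν hν k ρ hρ R hR => ?_⟩
  have hρ1 : 1 ≤ ρ := (one_le_ρ₀ m).trans hρ
  have hR1 : (1 : ℝ) ≤ 1 + R ^ 2 := by nlinarith
  -- the bound on the circle `|w - pt l ν| = δ`
  have h4' : 0 ≤ 4 * ρ / R := div_nonneg (by linarith) (by linarith)
  set A : ℝ := ‖p‖ * Real.exp (CA * (D + 1) * (1 + R ^ 2)) * (4 * ρ / R) ^ (S * m) with hAdef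
  have hA0 : 0 ≤ A := by positivity
  set B : ℝ := A * Real.exp (4 * Real.log c₀⁻¹ * D) with hBdef
  have hsphere : ∀ w ∈ sphere (pt l ν) δ, ‖F₂ L₁ L₂ D p w‖ ≤ B := by
    intro w hw
    have hwΛ₁ : w ∉ L₁.lattice := hb₁ ν (sphere_subset_closedBall hw)
    have hwΛ₂ : w ∉ L₂.lattice := hb₂ ν (sphere_subset_closedBall hw)
    have hσ₁ : c₀ ≤ ‖L₁.weierstrassSigma w‖ := (min_le_left _ _).trans (hlow₁ ν hν w hw)
    have hσ₂ : c₀ ≤ ‖L₂.weierstrassSigma w‖ := (min_le_right _ _).trans (hlow₂ ν hν w hw)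
    have hwn : ‖w‖ ≤ ρ := by
      have := norm_pt_add_le (l := l) hν (u := w - pt l ν)
        (by rw [mem_sphere_iff_norm] at hw; rw [hw]; exact hδ1)
      simpa using this.trans hρ
    have hG : ‖G₂ L₁ L₂ D p w‖ ≤ A := hA D S m p hF ρ hρ R hR w hwn
    have hpos : 0 < ‖L₁.weierstrassSigma w‖ ^ (2 * D) * ‖L₂.weierstrassSigma w‖ ^ (2 * D) :=
      mul_pos (pow_pos (hc₀.trans_le hσ₁) _) (pow_pos (hc₀.trans_le hσ₂) _)
    rw [norm_F₂_eq hwΛ₁ hwΛ₂ p, div_le_iff₀ hpos, hBdef]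
    have h1 : Real.exp (-(4 * Real.log c₀⁻¹ * D)) ≤
        ‖L₁.weierstrassSigma w‖ ^ (2 * D) * ‖L₂.weierstrassSigma w‖ ^ (2 * D) := by
      rw [show -(4 * Real.log c₀⁻¹ * D) = ((2 * D + 2 * D : ℕ) : ℝ) * Real.log c₀ by
        rw [Real.log_inv]; push_cast; ring, Real.exp_nat_mul, Real.exp_log hc₀, pow_add]
      exact mul_le_mul (pow_le_pow_left₀ hc₀.le hσ₁ _) (pow_le_pow_left₀ hc₀.le hσ₂ _)
        (by positivity) (by positivity)
    calc ‖G₂ L₁ L₂ D p w‖ ≤ A := hG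
      _ = A * Real.exp (4 * Real.log c₀⁻¹ * D) * Real.exp (-(4 * Real.log c₀⁻¹ * D)) := by
          rw [mul_assoc, ← Real.exp_add, add_neg_cancel, Real.exp_zero, mul_one]
      _ ≤ A * Real.exp (4 * Real.log c₀⁻¹ * D) *
          (‖L₁.weierstrassSigma w‖ ^ (2 * D) * ‖L₂.weierstrassSigma w‖ ^ (2 * D)) := by
          gcongr
  -- Cauchy's inequality
  have hdiff : DiffContOnCl ℂ (F₂ L₁ L₂ D p) (ball (pt l ν) δ) := by
    refine DifferentiableOn.diffContOnCl fun w hw => ?_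
    have hw' : w ∈ closedBall (pt l ν) δ := closure_ball_subset_closedBall hw
    exact (analyticAt_F₂ p (hb₁ ν hw') (hb₂ ν hw')).differentiableAt.differentiableWithinAt
  have hC := Complex.norm_iteratedDeriv_le_of_forall_mem_sphere_norm_le k hδ hdiff hsphere
  have hδk : (δ ^ k)⁻¹ ≤ Real.exp (Real.log δ⁻¹ * k) := by
    rw [mul_comm, Real.exp_nat_mul, Real.exp_log (inv_pos.mpr hδ), inv_pow]
  have h4 : 0 ≤ (4 * ρ / R) ^ (S * m) := pow_nonneg h4' _
  calc ‖iteratedDeriv k (F₂ L₁ L₂ D p) (pt l ν)‖ ≤ k.factorial * B / δ ^ k := hC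
    _ = k.factorial * B * (δ ^ k)⁻¹ := by rw [div_eq_mul_inv]
    _ ≤ k.factorial * B * Real.exp (Real.log δ⁻¹ * k) := by
        have : 0 ≤ (k.factorial : ℝ) * B := by rw [hBdef]; positivity
        exact mul_le_mul_of_nonneg_left hδk this
    _ = ‖p‖ * k.factorial * Real.exp (CA * (D + 1) * (1 + R ^ 2) + 4 * Real.log c₀⁻¹ * D +
          Real.log δ⁻¹ * k) * (4 * ρ / R) ^ (S * m) := by
        rw [hBdef, hAdef, Real.exp_add, Real.exp_add]; ring
    _ ≤ ‖p‖ * k.factorial * Real.exp ((CA + 4 * Real.log c₀⁻¹ + Real.log δ⁻¹) *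
          ((D + 1) * (1 + R ^ 2) + k)) * (4 * ρ / R) ^ (S * m) := by
        gcongr
        have h1 : (0 : ℝ) ≤ (D + 1) * (1 + R ^ 2) := by positivity
        have h2 : (0 : ℝ) ≤ k := by positivity
        have hD : (D : ℝ) ≤ (D + 1) * (1 + R ^ 2) := by nlinarith
        nlinarith [mul_nonneg hlogδ h1, mul_nonneg hlog h2, mul_nonneg hCA h2,
          mul_le_mul_of_nonneg_left hD hlog]

/-- If the auxiliary function does not vanish identically off `Λ₁ ∪ Λ₂`, it has FINITE order at
every point `pt l n` (identity theorem on the connected open set `ℂ ∖ (Λ₁ ∪ Λ₂)`; Baker 1975,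
Ch. 6, §5: "`Φ` vanishes identically … implies that `f₁` and `f₂` are algebraically dependent").
[cite: Baker1975, Ch. 6 §5 p. 59] -/
theorem analyticOrderAt_F₂_ne_top {L₁ L₂ : PeriodPair} {l : ℂ} (hl₁ : l ∈ L₁.lattice)
    (hl2₁ : l / 2 ∉ L₁.lattice) (hl₂ : l ∈ L₂.lattice) (hl2₂ : l / 2 ∉ L₂.lattice) {D : ℕ}
    {p : Fin (D + 1) × Fin (D + 1) → ℂ}
    (hF : ¬ ∀ z, z ∉ L₁.lattice → z ∉ L₂.lattice → F₂ L₁ L₂ D p z = 0) (n : ℕ) :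
    analyticOrderAt (F₂ L₁ L₂ D p) (pt l n) ≠ ⊤ := by
  intro htop
  rw [analyticOrderAt_eq_top] at htop
  refine hF fun z hz₁ hz₂ => ?_
  have hmem : pt l n ∈ ((L₁.lattice : Set ℂ) ∪ L₂.lattice)ᶜ := by
    rw [Set.compl_union]; exact ⟨pt_notMem hl₁ hl2₁ n, pt_notMem hl₂ hl2₂ n⟩
  have hz : z ∈ ((L₁.lattice : Set ℂ) ∪ L₂.lattice)ᶜ := by
    rw [Set.compl_union]; exact ⟨hz₁, hz₂⟩
  exact (analyticOnNhd_F₂ p).eqOn_zero_of_preconnected_of_eventuallyEq_zero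
    (isPreconnected_compl_union L₁ L₂) hmem htop hz

end Literature.NumberTheory.Transcendental.Schneider1937TwoP

end
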